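import Literature.InformationTheory.Entanglement.QuantumFisherInformationEntanglementCriterion
import HarnessLib

/-!
# Further properties of the quantum Fisher information (Tóth–Apellaniz § 4.3): invariance under a commuting shift
# `A ↦ A + D`, unitary covariance `F_Q[UρU†, A] = F_Q[ρ, U†AU]`, additivity under `⊗` and `⊕`, and the
# white-noise formula `F_Q[pP + (1−p)𝟙/d] = p²/(p + 2(1−p)/d)·F_Q[P]`

Hodge foundations lane (`lit-hodgefound`, prover p24 gen 79; quantum-information series, file 9).  THEOREMS
ONLY: no definition, no named fact, net debt 0.  SLD vocabulary of the g78/g79 `StateDiscrimination` files: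
`ρ ⪰ 0`, Hermitian generator `A`, `ρ̇ := i(ρA − Aρ)` (the family `e^{−iAθ}ρe^{iAθ}` at `θ = 0`), a Hermitian `S`
with `Sρ + ρS = ρ̇` (BF's SLD), and `F_Q[ρ, A] = 2Tr(Sρ̇)` — independent of the SLD chosen
(`QFIVariance.trace_sld_mul_eq_of_sld_eq`) and existing for every state (`QFIVariance.exists_sld_unitaryDeriv`).
Each identity below is proved by EXHIBITING an SLD of the transformed state from SLDs of the parts and computing
`2Tr(Sρ̇)`; the SLD-free readings follow by SLD independence.

## Source (read verbatim)

G. Tóth, I. Apellaniz, *Quantum metrology from a quantum information science perspective*, J. Phys. A **47**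
(2014) 424006 [TothApellaniz2014], § 4.3 (held `paper:arxiv-1405.4878` p0011–p0012): «we list some further useful
relations for the quantum Fisher information. … (i) The formula (eq:qF) does not depend on the diagonal elements
`⟨i|A|i⟩`. Hence, `F_Q[ϱ,A] = F_Q[ϱ,A+D]`, where `D` is a matrix that is diagonal in the basis of the eigenvectors
of `ϱ`, i.e., `[ϱ,D] = 0`.  (ii) The following identity holds for all unitary dynamics `U`:
`F_Q[UϱU†, A] = F_Q[ϱ, U†AU]`. … Hence, in particular, the quantum Fisher information does not change under
unitary dynamics governed by `A` as a Hamiltonian `F_Q[ϱ,A] = F_Q[e^{−iAθ}ϱe^{iAθ}, A]`.  (iii) The quantum Fisher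
information is additive under tensoring `F_Q[ϱ^{(1)} ⊗ ϱ^{(2)}, A^{(1)} ⊗ 𝟙 + 𝟙 ⊗ A^{(2)}] = F_Q[ϱ^{(1)}, A^{(1)}] +
F_Q[ϱ^{(2)}, A^{(2)}]`. …  (iv) The quantum Fisher information is additive under a direct sum
`F_Q[⊕_k p_kϱ_k, ⊕_k A_k] = Σ_k p_k F_Q[ϱ_k, A_k]`, where `ϱ_k` are density matrices with a unit trace and
`Σ_k p_k = 1`.  (v) If a pure quantum state `|Ψ⟩` … is mixed with white noise as `ϱ_noisy(p) = p|Ψ⟩⟨Ψ| +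
(1−p)𝟙/d^N`, then `F_Q[ϱ_noisy(p), A] = p²/(p + … ) F_Q[|Ψ⟩⟨Ψ|, A]`.  Thus, an additive global noise decreases
the quantum Fisher information by a constant factor.»  The noise factor as printed by G. Tóth, PRA **85** (2012)
022322 [Toth2012MultipartiteMetrology], § 4 eq. (after (mixed)): «`Γ_C^{(mixed)}(p) = p²/(p + (1−p)2^{−(N−1)}) Γ_C`»
— i.e. `p²/(p + 2(1−p)/d)` with `d = 2^N` the total dimension; THIS is the factor proved below (for every
dimension `d = |n|`), which fixes the reading of the review's display.

## What is formalized (all PROVED)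

§ 1 (i) `unitaryDeriv_add_of_commute` (`ρ̇_{A+D} = ρ̇_A` when `ρD = Dρ`) and `qfi_add_of_commute`.
§ 2 (ii) `conj_unitaryDeriv` (`U ρ̇_{ρ, U†AU} U† = ρ̇_{UρU†, A}`), `sld_conj` (`US'U†` is an SLD of `UρU†`),
**`qfi_unitary_conj`** (`2Tr((US'U†) ρ̇_{UρU†,A}) = 2Tr(S' ρ̇_{ρ,U†AU})`), the SLD-free form **`qfi_unitary_conj_eq`**
(any Hermitian SLD `T` of `UρU†` along `A` gives `F_Q[ρ, U†AU]`), and `qfi_conj_of_commute` (`F_Q[UρU†, A] = F_Q[ρ, A]`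
when `U†AU = A`, e.g. `U = e^{−iAθ}`).
§ 3 (iii) on `Matrix (m × k)`: `unitaryDeriv_kronecker` (`ρ̇ = ρ̇₁ ⊗ ρ₂ + ρ₁ ⊗ ρ̇₂`), `sld_kronecker`
(`S₁ ⊗ 𝟙 + 𝟙 ⊗ S₂` is an SLD), **`qfi_kronecker`** (`= F_Q[ρ₁,A₁]·Tr ρ₂ + Tr ρ₁·F_Q[ρ₂,A₂]`, so `F₁ + F₂` for
states) and the SLD-free **`qfi_kronecker_eq`**.
§ 4 (iv) binary direct sums on `Matrix (m ⊕ k)`: `sld_fromBlocks`, **`qfi_fromBlocks`** (`F_Q[p₁ρ₁ ⊕ p₂ρ₂, A₁ ⊕ A₂]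
= p₁F_Q[ρ₁,A₁] + p₂F_Q[ρ₂,A₂]`).
§ 5 (v) white noise: `sld_whiteNoise` (the SLD `(p/(p + 2q))·Ṗ` of `pP + q𝟙`, `P = |ψ⟩⟨ψ|`), **`qfi_whiteNoise`**
(`F_Q[pP + q𝟙, A] = p²/(p + 2q)·F_Q[P, A]` for every `q` with `p + 2q ≠ 0`; `q = (1−p)/d` is the printed case) and
the SLD-free `qfi_whiteNoise_eq`.

NOT formalized: the `N`-fold tensor power `F_Q[ϱ^{⊗N}, Σ_n A^{(n)}] = NF_Q[ϱ,A]` and `k`-fold direct sums (iterated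
versions of § 3–§ 4), (vi) monotonicity under partial trace.  Tree search (FAIL-DUP, 2026-09-01): `rg -n
"kronecker" Literature/InformationTheory/StateDiscrimination` → none; the QFI files of the series have no
`⊗`/`⊕`/unitary-covariance statements; `QuantumCramerRaoBound.lean` lists «the `N`-copy additivity (24.23)» as NOT
formalised (§ 3 is its `N = 2` building block).
-/

noncomputable section

open scoped BigOperators ComplexOrder ComplexConjugate Kronecker
open Matrix Complex Finset
open Literature.InformationTheory.StateDiscrimination

namespace Literature.InformationTheory.StateDiscrimination.QFIProperties

open Literature.InformationTheory.Entanglement.QFICriterion (sld_vecMulVec)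

variable {n : Type*} [Fintype n] [DecidableEq n]

/-- `Re(2z) = 2Re z`. [folklore] -/
private theorem re_two_mul (z : ℂ) : (2 * z).re = 2 * z.re := by
  simp only [Complex.mul_re, Complex.re_ofNat, Complex.im_ofNat, zero_mul, sub_zero]

/-! ## § 1 (i) A generator shift commuting with the state does not change `ρ̇` -/

omit [DecidableEq n] in
/-- **(i)**: if `ρD = Dρ` then `ρ̇_{A+D} = i(ρ(A+D) − (A+D)ρ) = i(ρA − Aρ) = ρ̇_A`. [cite: TothApellaniz2014, §4.3 (i)] -/
theorem unitaryDeriv_add_of_commute {ρ A D : Matrix n n ℂ} (h : ρ * D = D * ρ) :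
    Complex.I • (ρ * (A + D) - (A + D) * ρ) = Complex.I • (ρ * A - A * ρ) := by
  rw [Matrix.mul_add, Matrix.add_mul, h]
  congr 1
  abel

omit [DecidableEq n] in
/-- **(i) `F_Q[ρ, A + D] = F_Q[ρ, A]` for `[ρ, D] = 0`**: the SLD equations along `A` and `A + D` coincide, and so
do the values `2Tr(Sρ̇)` for every `S`. [cite: TothApellaniz2014, §4.3 (i) eq. (`F_Q[ϱ,A] = F_Q[ϱ,A+D]`)] -/
theorem qfi_add_of_commute {ρ A D : Matrix n n ℂ} (h : ρ * D = D * ρ) (S : Matrix n n ℂ) :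
    (2 * (S * (Complex.I • (ρ * (A + D) - (A + D) * ρ))).trace).re =
      (2 * (S * (Complex.I • (ρ * A - A * ρ))).trace).re := by
  rw [unitaryDeriv_add_of_commute h]

/-! ## § 2 (ii) Unitary covariance `F_Q[UρU†, A] = F_Q[ρ, U†AU]` -/

section Unitary

variable {ρ A U S' : Matrix n n ℂ}

/-- `U ρ̇_{ρ, U†AU} U† = ρ̇_{UρU†, A}` for `UU† = 𝟙`. [cite: TothApellaniz2014, §4.3 (ii)] -/
theorem conj_unitaryDeriv (hU : U * Uᴴ = 1) (ρ A : Matrix n n ℂ) :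
    U * (Complex.I • (ρ * (Uᴴ * A * U) - (Uᴴ * A * U) * ρ)) * Uᴴ =
      Complex.I • ((U * ρ * Uᴴ) * A - A * (U * ρ * Uᴴ)) := by
  rw [Matrix.mul_smul, Matrix.smul_mul, Matrix.mul_sub, Matrix.sub_mul]
  congr 1
  have e1 : U * (ρ * (Uᴴ * A * U)) * Uᴴ = U * ρ * Uᴴ * A := by
    calc U * (ρ * (Uᴴ * A * U)) * Uᴴ = U * ρ * Uᴴ * A * (U * Uᴴ) := by
          simp only [Matrix.mul_assoc]
      _ = U * ρ * Uᴴ * A := by rw [hU, Matrix.mul_one]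
  have e2 : U * ((Uᴴ * A * U) * ρ) * Uᴴ = A * (U * ρ * Uᴴ) := by
    calc U * ((Uᴴ * A * U) * ρ) * Uᴴ = (U * Uᴴ) * (A * (U * ρ * Uᴴ)) := by
          simp only [Matrix.mul_assoc]
      _ = A * (U * ρ * Uᴴ) := by rw [hU, Matrix.one_mul]
  rw [e1, e2]

/-- **Transport of SLDs**: if `S'` is an SLD of `ρ` along `U†AU` then `US'U†` is an SLD of `UρU†` along `A`
(`U†U = UU† = 𝟙`). [cite: TothApellaniz2014, §4.3 (ii)] -/
theorem sld_conj (hU : U * Uᴴ = 1) (hU' : Uᴴ * U = 1)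
    (hS' : S' * ρ + ρ * S' = Complex.I • (ρ * (Uᴴ * A * U) - (Uᴴ * A * U) * ρ)) :
    (U * S' * Uᴴ) * (U * ρ * Uᴴ) + (U * ρ * Uᴴ) * (U * S' * Uᴴ) =
      Complex.I • ((U * ρ * Uᴴ) * A - A * (U * ρ * Uᴴ)) := by
  rw [← conj_unitaryDeriv hU, ← hS', Matrix.mul_add, Matrix.add_mul]
  congr 1
  · calc U * S' * Uᴴ * (U * ρ * Uᴴ) = U * S' * (Uᴴ * U) * ρ * Uᴴ := by simp only [Matrix.mul_assoc]
      _ = U * (S' * ρ) * Uᴴ := by rw [hU', Matrix.mul_one, Matrix.mul_assoc U S' ρ]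
  · calc U * ρ * Uᴴ * (U * S' * Uᴴ) = U * ρ * (Uᴴ * U) * S' * Uᴴ := by simp only [Matrix.mul_assoc]
      _ = U * (ρ * S') * Uᴴ := by rw [hU', Matrix.mul_one, Matrix.mul_assoc U ρ S']

/-- **(ii) `F_Q[UρU†, A] = F_Q[ρ, U†AU]`, SLD form**: with the transported SLD `US'U†`,
`2Tr((US'U†)·ρ̇_{UρU†,A}) = 2Tr(S'·ρ̇_{ρ,U†AU})` («The left- and right-hand sides … are similar to the Schrödinger
picture and the Heisenberg picture»). [cite: TothApellaniz2014, §4.3 (ii) eq. (SH)] -/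
theorem qfi_unitary_conj (hU : U * Uᴴ = 1) (hU' : Uᴴ * U = 1) (ρ A S' : Matrix n n ℂ) :
    (2 * ((U * S' * Uᴴ) * (Complex.I • ((U * ρ * Uᴴ) * A - A * (U * ρ * Uᴴ)))).trace).re =
      (2 * (S' * (Complex.I • (ρ * (Uᴴ * A * U) - (Uᴴ * A * U) * ρ))).trace).re := by
  rw [← conj_unitaryDeriv hU]
  congr 2
  calc (U * S' * Uᴴ * (U * (Complex.I • (ρ * (Uᴴ * A * U) - Uᴴ * A * U * ρ)) * Uᴴ)).trace
      = (U * (S' * (Uᴴ * U) * (Complex.I • (ρ * (Uᴴ * A * U) - Uᴴ * A * U * ρ))) * Uᴴ).trace := by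
        simp only [Matrix.mul_assoc]
    _ = (S' * (Complex.I • (ρ * (Uᴴ * A * U) - Uᴴ * A * U * ρ))).trace := by
        rw [hU', Matrix.mul_one, Matrix.trace_mul_comm, ← Matrix.mul_assoc, hU', Matrix.one_mul]

/-- **(ii), SLD-free form**: for a state `ρ ⪰ 0`, Hermitian `A`, a unitary `U`, ANY Hermitian SLD `T` of `UρU†` along
`A` and ANY Hermitian SLD `S'` of `ρ` along `U†AU`: `2Tr(Tρ̇_{UρU†,A}) = 2Tr(S'ρ̇_{ρ,U†AU})`. [cite: TothApellaniz2014,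
§4.3 (ii) eq. (SH)] -/
theorem qfi_unitary_conj_eq (hρ : ρ.PosSemidef) (hU : U * Uᴴ = 1) (hU' : Uᴴ * U = 1) {T : Matrix n n ℂ}
    (hT : T.IsHermitian) (hTρ : T * (U * ρ * Uᴴ) + (U * ρ * Uᴴ) * T = Complex.I • ((U * ρ * Uᴴ) * A - A * (U * ρ * Uᴴ)))
    (hS' : S'.IsHermitian) (hS'ρ : S' * ρ + ρ * S' = Complex.I • (ρ * (Uᴴ * A * U) - (Uᴴ * A * U) * ρ)) :
    (2 * (T * (Complex.I • ((U * ρ * Uᴴ) * A - A * (U * ρ * Uᴴ)))).trace).re =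
      (2 * (S' * (Complex.I • (ρ * (Uᴴ * A * U) - (Uᴴ * A * U) * ρ))).trace).re := by
  have hρU : (U * ρ * Uᴴ).PosSemidef := hρ.mul_mul_conjTranspose_same U
  have hSU : (U * S' * Uᴴ).IsHermitian := isHermitian_mul_mul_conjTranspose U hS'
  rw [QFIVariance.trace_sld_mul_eq_of_sld_eq hρU hT hSU hTρ (sld_conj hU hU' hS'ρ), qfi_unitary_conj hU hU']

/-- **`F_Q[UρU†, A] = F_Q[ρ, A]` when `U` commutes with `A`** (`U†AU = A`; e.g. `U = e^{−iAθ}`: «the quantum Fisher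
information does not change under unitary dynamics governed by `A` as a Hamiltonian»), SLD-free form.
[cite: TothApellaniz2014, §4.3 (ii) eq. (`F_Q[ϱ,A] = F_Q[e^{−iAθ}ϱe^{iAθ},A]`)] -/
theorem qfi_conj_of_commute (hρ : ρ.PosSemidef) (hU : U * Uᴴ = 1) (hU' : Uᴴ * U = 1) (hA : Uᴴ * A * U = A)
    {T S : Matrix n n ℂ} (hT : T.IsHermitian)
    (hTρ : T * (U * ρ * Uᴴ) + (U * ρ * Uᴴ) * T = Complex.I • ((U * ρ * Uᴴ) * A - A * (U * ρ * Uᴴ)))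
    (hS : S.IsHermitian) (hSρ : S * ρ + ρ * S = Complex.I • (ρ * A - A * ρ)) :
    (2 * (T * (Complex.I • ((U * ρ * Uᴴ) * A - A * (U * ρ * Uᴴ)))).trace).re =
      (2 * (S * (Complex.I • (ρ * A - A * ρ))).trace).re := by
  have h := qfi_unitary_conj_eq (A := A) hρ hU hU' hT hTρ hS (by rw [hA]; exact hSρ)
  rwa [hA] at h

end Unitary

/-! ## § 3 (iii) Additivity under tensor products -/

section Kronecker

variable {m k : Type*} [Fintype m] [DecidableEq m] [Fintype k] [DecidableEq k]

omit [Fintype m] [DecidableEq m] [Fintype k] [DecidableEq k] in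
/-- `(A₁ − A₂) ⊗ B = A₁ ⊗ B − A₂ ⊗ B`. [folklore] -/
private theorem sub_kronecker (A₁ A₂ : Matrix m m ℂ) (B : Matrix k k ℂ) :
    (A₁ - A₂) ⊗ₖ B = A₁ ⊗ₖ B - A₂ ⊗ₖ B := by
  ext ⟨i, i'⟩ ⟨j, j'⟩; simp [Matrix.kroneckerMap_apply, sub_mul]

omit [Fintype m] [DecidableEq m] [Fintype k] [DecidableEq k] in
/-- `A ⊗ (B₁ − B₂) = A ⊗ B₁ − A ⊗ B₂`. [folklore] -/
private theorem kronecker_sub (A : Matrix m m ℂ) (B₁ B₂ : Matrix k k ℂ) :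
    A ⊗ₖ (B₁ - B₂) = A ⊗ₖ B₁ - A ⊗ₖ B₂ := by
  ext ⟨i, i'⟩ ⟨j, j'⟩; simp [Matrix.kroneckerMap_apply, mul_sub]

/-- **`ρ̇ = ρ̇₁ ⊗ ρ₂ + ρ₁ ⊗ ρ̇₂`** for `ρ = ρ₁ ⊗ ρ₂` and the generator `A₁ ⊗ 𝟙 + 𝟙 ⊗ A₂`. [cite: TothApellaniz2014,
§4.3 (iii)] -/
theorem unitaryDeriv_kronecker (ρ₁ A₁ : Matrix m m ℂ) (ρ₂ A₂ : Matrix k k ℂ) :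
    Complex.I • ((ρ₁ ⊗ₖ ρ₂) * (A₁ ⊗ₖ (1 : Matrix k k ℂ) + (1 : Matrix m m ℂ) ⊗ₖ A₂) -
        (A₁ ⊗ₖ (1 : Matrix k k ℂ) + (1 : Matrix m m ℂ) ⊗ₖ A₂) * (ρ₁ ⊗ₖ ρ₂)) =
      (Complex.I • (ρ₁ * A₁ - A₁ * ρ₁)) ⊗ₖ ρ₂ + ρ₁ ⊗ₖ (Complex.I • (ρ₂ * A₂ - A₂ * ρ₂)) := by
  rw [Matrix.mul_add, Matrix.add_mul, ← Matrix.mul_kronecker_mul, ← Matrix.mul_kronecker_mul, ← Matrix.mul_kronecker_mul,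
    ← Matrix.mul_kronecker_mul, Matrix.mul_one, Matrix.one_mul, Matrix.mul_one, Matrix.one_mul, Matrix.smul_kronecker,
    Matrix.kronecker_smul, ← smul_add, sub_kronecker, kronecker_sub]
  congr 1
  abel

/-- **`S₁ ⊗ 𝟙 + 𝟙 ⊗ S₂` is an SLD of `ρ₁ ⊗ ρ₂`** along `A₁ ⊗ 𝟙 + 𝟙 ⊗ A₂`, given SLDs `S₁, S₂` of the factors.
[cite: TothApellaniz2014, §4.3 (iii)] -/
theorem sld_kronecker {ρ₁ A₁ S₁ : Matrix m m ℂ} {ρ₂ A₂ S₂ : Matrix k k ℂ}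
    (h₁ : S₁ * ρ₁ + ρ₁ * S₁ = Complex.I • (ρ₁ * A₁ - A₁ * ρ₁))
    (h₂ : S₂ * ρ₂ + ρ₂ * S₂ = Complex.I • (ρ₂ * A₂ - A₂ * ρ₂)) :
    (S₁ ⊗ₖ (1 : Matrix k k ℂ) + (1 : Matrix m m ℂ) ⊗ₖ S₂) * (ρ₁ ⊗ₖ ρ₂) +
        (ρ₁ ⊗ₖ ρ₂) * (S₁ ⊗ₖ (1 : Matrix k k ℂ) + (1 : Matrix m m ℂ) ⊗ₖ S₂) =
      Complex.I • ((ρ₁ ⊗ₖ ρ₂) * (A₁ ⊗ₖ (1 : Matrix k k ℂ) + (1 : Matrix m m ℂ) ⊗ₖ A₂) -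
        (A₁ ⊗ₖ (1 : Matrix k k ℂ) + (1 : Matrix m m ℂ) ⊗ₖ A₂) * (ρ₁ ⊗ₖ ρ₂)) := by
  rw [unitaryDeriv_kronecker, ← h₁, ← h₂, Matrix.add_mul, Matrix.mul_add, ← Matrix.mul_kronecker_mul,
    ← Matrix.mul_kronecker_mul, ← Matrix.mul_kronecker_mul, ← Matrix.mul_kronecker_mul, Matrix.mul_one, Matrix.one_mul,
    Matrix.mul_one, Matrix.one_mul, Matrix.add_kronecker, Matrix.kronecker_add]
  abel

/-- **(iii) Additivity under tensoring, SLD form**: with the SLD `S₁ ⊗ 𝟙 + 𝟙 ⊗ S₂`,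
`2Tr(Sρ̇) = 2Tr(S₁ρ̇₁)·Tr ρ₂ + Tr ρ₁·2Tr(S₂ρ̇₂)` (the cross terms vanish by `Tr ρ̇ᵢ = 0`; a trace identity valid for
all `S₁, S₂`); for states (`Tr ρ₁ = Tr ρ₂ = 1`) this is `F_Q[ρ₁, A₁] + F_Q[ρ₂, A₂]`. [cite: TothApellaniz2014, §4.3 (iii) eq.
(`F_Q[ϱ^{(1)}⊗ϱ^{(2)}, A^{(1)}⊗𝟙 + 𝟙⊗A^{(2)}] = F_Q[ϱ^{(1)},A^{(1)}] + F_Q[ϱ^{(2)},A^{(2)}]`)] -/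
theorem qfi_kronecker {ρ₁ : Matrix m m ℂ} {ρ₂ : Matrix k k ℂ} (hρ₁ : ρ₁.trace = 1) (hρ₂ : ρ₂.trace = 1)
    (A₁ S₁ : Matrix m m ℂ) (A₂ S₂ : Matrix k k ℂ) :
    (2 * ((S₁ ⊗ₖ (1 : Matrix k k ℂ) + (1 : Matrix m m ℂ) ⊗ₖ S₂) *
        (Complex.I • ((ρ₁ ⊗ₖ ρ₂) * (A₁ ⊗ₖ (1 : Matrix k k ℂ) + (1 : Matrix m m ℂ) ⊗ₖ A₂) -
          (A₁ ⊗ₖ (1 : Matrix k k ℂ) + (1 : Matrix m m ℂ) ⊗ₖ A₂) * (ρ₁ ⊗ₖ ρ₂)))).trace).re =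
      (2 * (S₁ * (Complex.I • (ρ₁ * A₁ - A₁ * ρ₁))).trace).re +
        (2 * (S₂ * (Complex.I • (ρ₂ * A₂ - A₂ * ρ₂))).trace).re := by
  have hD₁ : (Complex.I • (ρ₁ * A₁ - A₁ * ρ₁)).trace = 0 := QFIVariance.trace_unitaryDeriv ρ₁ A₁
  have hD₂ : (Complex.I • (ρ₂ * A₂ - A₂ * ρ₂)).trace = 0 := QFIVariance.trace_unitaryDeriv ρ₂ A₂
  rw [unitaryDeriv_kronecker, Matrix.add_mul, Matrix.mul_add, Matrix.mul_add, ← Matrix.mul_kronecker_mul,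
    ← Matrix.mul_kronecker_mul, ← Matrix.mul_kronecker_mul, ← Matrix.mul_kronecker_mul]
  simp only [trace_add, Matrix.trace_kronecker, hD₁, hD₂, hρ₁, hρ₂, mul_zero, zero_mul, add_zero, zero_add,
    mul_one, one_mul]
  rw [mul_add, Complex.add_re]

/-- **(iii), SLD-free form**: for states `ρ₁, ρ₂ ⪰ 0` of unit trace, Hermitian generators, ANY Hermitian SLD `T` of
`ρ₁ ⊗ ρ₂` along `A₁ ⊗ 𝟙 + 𝟙 ⊗ A₂` and ANY Hermitian SLDs `S₁, S₂` of the factors: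
`F_Q[ρ₁ ⊗ ρ₂] = F_Q[ρ₁, A₁] + F_Q[ρ₂, A₂]`. [cite: TothApellaniz2014, §4.3 (iii)] -/
theorem qfi_kronecker_eq {ρ₁ A₁ S₁ : Matrix m m ℂ} {ρ₂ A₂ S₂ : Matrix k k ℂ} (hρ₁ : ρ₁.PosSemidef)
    (hρ₂ : ρ₂.PosSemidef) (hρ₁1 : ρ₁.trace = 1) (hρ₂1 : ρ₂.trace = 1) (hS₁ : S₁.IsHermitian) (hS₂ : S₂.IsHermitian)
    (h₁ : S₁ * ρ₁ + ρ₁ * S₁ = Complex.I • (ρ₁ * A₁ - A₁ * ρ₁))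
    (h₂ : S₂ * ρ₂ + ρ₂ * S₂ = Complex.I • (ρ₂ * A₂ - A₂ * ρ₂))
    {T : Matrix (m × k) (m × k) ℂ} (hT : T.IsHermitian)
    (hTρ : T * (ρ₁ ⊗ₖ ρ₂) + (ρ₁ ⊗ₖ ρ₂) * T =
      Complex.I • ((ρ₁ ⊗ₖ ρ₂) * (A₁ ⊗ₖ (1 : Matrix k k ℂ) + (1 : Matrix m m ℂ) ⊗ₖ A₂) -
        (A₁ ⊗ₖ (1 : Matrix k k ℂ) + (1 : Matrix m m ℂ) ⊗ₖ A₂) * (ρ₁ ⊗ₖ ρ₂))) :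
    (2 * (T * (Complex.I • ((ρ₁ ⊗ₖ ρ₂) * (A₁ ⊗ₖ (1 : Matrix k k ℂ) + (1 : Matrix m m ℂ) ⊗ₖ A₂) -
        (A₁ ⊗ₖ (1 : Matrix k k ℂ) + (1 : Matrix m m ℂ) ⊗ₖ A₂) * (ρ₁ ⊗ₖ ρ₂)))).trace).re =
      (2 * (S₁ * (Complex.I • (ρ₁ * A₁ - A₁ * ρ₁))).trace).re +
        (2 * (S₂ * (Complex.I • (ρ₂ * A₂ - A₂ * ρ₂))).trace).re := by
  have hρ : (ρ₁ ⊗ₖ ρ₂).PosSemidef := hρ₁.kronecker hρ₂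
  have hS : (S₁ ⊗ₖ (1 : Matrix k k ℂ) + (1 : Matrix m m ℂ) ⊗ₖ S₂).IsHermitian := by
    rw [Matrix.IsHermitian, conjTranspose_add, conjTranspose_kronecker, conjTranspose_kronecker, hS₁.eq, hS₂.eq,
      conjTranspose_one, conjTranspose_one]
  rw [QFIVariance.trace_sld_mul_eq_of_sld_eq hρ hT hS hTρ (sld_kronecker h₁ h₂), qfi_kronecker hρ₁1 hρ₂1]

end Kronecker

/-! ## § 4 (iv) Additivity under direct sums -/

section DirectSum

variable {m k : Type*} [Fintype m] [Fintype k]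

/-- `Tr(A ⊕ D) = Tr A + Tr D`. [folklore] -/
private theorem trace_fromBlocks' (A : Matrix m m ℂ) (B : Matrix m k ℂ) (C : Matrix k m ℂ) (D : Matrix k k ℂ) :
    (fromBlocks A B C D).trace = A.trace + D.trace := by
  simp [Matrix.trace, Fintype.sum_sum_type]

/-- The derivative of a direct sum: `ρ̇ = p₁ρ̇₁ ⊕ p₂ρ̇₂` for `ρ = p₁ρ₁ ⊕ p₂ρ₂`, `A = A₁ ⊕ A₂`. [cite:
TothApellaniz2014, §4.3 (iv)] -/
theorem unitaryDeriv_fromBlocks (p₁ p₂ : ℝ) (ρ₁ A₁ : Matrix m m ℂ) (ρ₂ A₂ : Matrix k k ℂ) :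
    Complex.I • (fromBlocks ((p₁ : ℂ) • ρ₁) 0 0 ((p₂ : ℂ) • ρ₂) * fromBlocks A₁ 0 0 A₂ -
        fromBlocks A₁ 0 0 A₂ * fromBlocks ((p₁ : ℂ) • ρ₁) 0 0 ((p₂ : ℂ) • ρ₂)) =
      fromBlocks ((p₁ : ℂ) • (Complex.I • (ρ₁ * A₁ - A₁ * ρ₁))) 0 0
        ((p₂ : ℂ) • (Complex.I • (ρ₂ * A₂ - A₂ * ρ₂))) := by
  rw [fromBlocks_multiply, fromBlocks_multiply, sub_eq_add_neg, fromBlocks_neg, fromBlocks_add, fromBlocks_smul]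
  simp only [Matrix.mul_zero, Matrix.zero_mul, add_zero, zero_add, neg_zero, smul_zero, Matrix.smul_mul,
    Matrix.mul_smul]
  congr 1 <;> module

/-- **`S₁ ⊕ S₂` is an SLD of `p₁ρ₁ ⊕ p₂ρ₂` along `A₁ ⊕ A₂`.** [cite: TothApellaniz2014, §4.3 (iv)] -/
theorem sld_fromBlocks (p₁ p₂ : ℝ) {ρ₁ A₁ S₁ : Matrix m m ℂ} {ρ₂ A₂ S₂ : Matrix k k ℂ}
    (h₁ : S₁ * ρ₁ + ρ₁ * S₁ = Complex.I • (ρ₁ * A₁ - A₁ * ρ₁))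
    (h₂ : S₂ * ρ₂ + ρ₂ * S₂ = Complex.I • (ρ₂ * A₂ - A₂ * ρ₂)) :
    fromBlocks S₁ 0 0 S₂ * fromBlocks ((p₁ : ℂ) • ρ₁) 0 0 ((p₂ : ℂ) • ρ₂) +
        fromBlocks ((p₁ : ℂ) • ρ₁) 0 0 ((p₂ : ℂ) • ρ₂) * fromBlocks S₁ 0 0 S₂ =
      Complex.I • (fromBlocks ((p₁ : ℂ) • ρ₁) 0 0 ((p₂ : ℂ) • ρ₂) * fromBlocks A₁ 0 0 A₂ -
        fromBlocks A₁ 0 0 A₂ * fromBlocks ((p₁ : ℂ) • ρ₁) 0 0 ((p₂ : ℂ) • ρ₂)) := by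
  rw [unitaryDeriv_fromBlocks, fromBlocks_multiply, fromBlocks_multiply, fromBlocks_add, ← h₁, ← h₂]
  simp only [Matrix.mul_zero, Matrix.zero_mul, add_zero, zero_add, Matrix.smul_mul, Matrix.mul_smul, smul_add,
    smul_zero]

/-- **(iv) Additivity under a direct sum** (binary case): with the SLD `S₁ ⊕ S₂` (`sld_fromBlocks`),
`F_Q[p₁ρ₁ ⊕ p₂ρ₂, A₁ ⊕ A₂] = p₁F_Q[ρ₁, A₁] + p₂F_Q[ρ₂, A₂]` (a trace identity valid for all `S₁, S₂`). [cite: TothApellaniz2014, §4.3 (iv) eq. (directsum)] -/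
theorem qfi_fromBlocks (p₁ p₂ : ℝ) (ρ₁ A₁ S₁ : Matrix m m ℂ) (ρ₂ A₂ S₂ : Matrix k k ℂ) :
    (2 * (fromBlocks S₁ 0 0 S₂ * (Complex.I • (fromBlocks ((p₁ : ℂ) • ρ₁) 0 0 ((p₂ : ℂ) • ρ₂) * fromBlocks A₁ 0 0 A₂ -
        fromBlocks A₁ 0 0 A₂ * fromBlocks ((p₁ : ℂ) • ρ₁) 0 0 ((p₂ : ℂ) • ρ₂)))).trace).re =
      p₁ * (2 * (S₁ * (Complex.I • (ρ₁ * A₁ - A₁ * ρ₁))).trace).re +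
        p₂ * (2 * (S₂ * (Complex.I • (ρ₂ * A₂ - A₂ * ρ₂))).trace).re := by
  rw [unitaryDeriv_fromBlocks, fromBlocks_multiply, trace_fromBlocks']
  simp only [Matrix.mul_zero, add_zero, zero_add, Matrix.mul_smul, trace_smul, smul_eq_mul]
  rw [mul_add, Complex.add_re, re_two_mul, re_two_mul, re_two_mul, re_two_mul, Complex.re_ofReal_mul,
    Complex.re_ofReal_mul]
  ring

end DirectSum

/-! ## § 5 (v) Global white noise: `F_Q[pP + q𝟙, A] = p²/(p + 2q)·F_Q[P, A]` -/

section WhiteNoise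

variable {ψ : n → ℂ} {A : Matrix n n ℂ}

/-- **The SLD of the noisy state**: for a unit `ψ`, `P = |ψ⟩⟨ψ|`, Hermitian `A`, `Ṗ = i(PA − AP)` and reals `p, q`
with `p + 2q ≠ 0`, the operator `S = (p/(p+2q))·Ṗ` satisfies `Sρ + ρS = ρ̇ = pṖ` for `ρ = pP + q𝟙` (using
`ṖP + PṖ = Ṗ`, `QFICriterion.sld_vecMulVec`). [cite: TothApellaniz2014, §4.3 (v)] [cite: Toth2012MultipartiteMetrology,
§4 eq. (mixed)] -/
theorem sld_whiteNoise (hA : A.IsHermitian) (hψ : star ψ ⬝ᵥ ψ = 1) {p q : ℝ} (hpq : p + 2 * q ≠ 0) :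
    ((p / (p + 2 * q) : ℝ) : ℂ) • (Complex.I • (vecMulVec ψ (star ψ) * A - A * vecMulVec ψ (star ψ))) *
          ((p : ℂ) • vecMulVec ψ (star ψ) + (q : ℂ) • (1 : Matrix n n ℂ)) +
        ((p : ℂ) • vecMulVec ψ (star ψ) + (q : ℂ) • (1 : Matrix n n ℂ)) *
          (((p / (p + 2 * q) : ℝ) : ℂ) • (Complex.I • (vecMulVec ψ (star ψ) * A - A * vecMulVec ψ (star ψ)))) =
      Complex.I • (((p : ℂ) • vecMulVec ψ (star ψ) + (q : ℂ) • (1 : Matrix n n ℂ)) * A -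
        A * ((p : ℂ) • vecMulVec ψ (star ψ) + (q : ℂ) • (1 : Matrix n n ℂ))) := by
  have hP := sld_vecMulVec hA hψ
  generalize vecMulVec ψ (star ψ) = P at hP ⊢
  generalize hD : Complex.I • (P * A - A * P) = D at hP
  -- right-hand side: `ρ̇ = pṖ`
  have hrhs : Complex.I • (((p : ℂ) • P + (q : ℂ) • (1 : Matrix n n ℂ)) * A -
      A * ((p : ℂ) • P + (q : ℂ) • (1 : Matrix n n ℂ))) = (p : ℂ) • D := by
    rw [← hD, Matrix.add_mul, Matrix.mul_add, Matrix.smul_mul, Matrix.smul_mul, Matrix.mul_smul, Matrix.mul_smul,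
      Matrix.one_mul, Matrix.mul_one, smul_comm (p : ℂ) Complex.I]
    congr 1
    module
  rw [hrhs, Matrix.smul_mul, Matrix.mul_smul, Matrix.mul_add, Matrix.add_mul, Matrix.mul_smul, Matrix.mul_smul,
    Matrix.smul_mul, Matrix.smul_mul, Matrix.mul_one, Matrix.one_mul, ← smul_add]
  -- `c • (p • DP + q • D + (p • PD + q • D)) = p • D` with `DP + PD = D`
  have e : (p : ℂ) • (D * P) + (q : ℂ) • D + ((p : ℂ) • (P * D) + (q : ℂ) • D) = ((p + 2 * q : ℝ) : ℂ) • D := by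
    rw [show (p : ℂ) • (D * P) + (q : ℂ) • D + ((p : ℂ) • (P * D) + (q : ℂ) • D) =
      (p : ℂ) • (D * P + P * D) + (2 * (q : ℂ)) • D by rw [smul_add]; module, hP]
    push_cast
    module
  rw [e, smul_smul, ← Complex.ofReal_mul, div_mul_cancel₀ _ hpq]

/-- **(v) The white-noise formula, SLD form**: with the SLD of `sld_whiteNoise`,
`2Tr(S·ρ̇) = p²/(p + 2q) · 2Tr(Ṗ·Ṗ)`, and `2Tr(ṖṖ) = F_Q[P, A]` (the pure state's own SLD is `Ṗ`). For
`q = (1−p)/d` this is `F_Q[ϱ_noisy(p), A] = p²/(p + 2(1−p)/d)·F_Q[|ψ⟩⟨ψ|, A]` — Tóth's `p²/(p + (1−p)2^{−(N−1)})`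
for `d = 2^N`. [cite: Toth2012MultipartiteMetrology, §4 eq. (mixed)] [cite: TothApellaniz2014, §4.3 (v)] -/
theorem qfi_whiteNoise (p q : ℝ) (ψ : n → ℂ) (A : Matrix n n ℂ) :
    (2 * ((((p / (p + 2 * q) : ℝ) : ℂ) • (Complex.I • (vecMulVec ψ (star ψ) * A - A * vecMulVec ψ (star ψ)))) *
        (Complex.I • (((p : ℂ) • vecMulVec ψ (star ψ) + (q : ℂ) • (1 : Matrix n n ℂ)) * A -
          A * ((p : ℂ) • vecMulVec ψ (star ψ) + (q : ℂ) • (1 : Matrix n n ℂ))))).trace).re =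
      p ^ 2 / (p + 2 * q) *
        (2 * ((Complex.I • (vecMulVec ψ (star ψ) * A - A * vecMulVec ψ (star ψ))) *
          (Complex.I • (vecMulVec ψ (star ψ) * A - A * vecMulVec ψ (star ψ)))).trace).re := by
  generalize vecMulVec ψ (star ψ) = P
  have hrhs : Complex.I • (((p : ℂ) • P + (q : ℂ) • (1 : Matrix n n ℂ)) * A -
      A * ((p : ℂ) • P + (q : ℂ) • (1 : Matrix n n ℂ))) = (p : ℂ) • (Complex.I • (P * A - A * P)) := by
    rw [Matrix.add_mul, Matrix.mul_add, Matrix.smul_mul, Matrix.smul_mul, Matrix.mul_smul, Matrix.mul_smul,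
      Matrix.one_mul, Matrix.mul_one, smul_comm (p : ℂ) Complex.I]
    congr 1
    module
  rw [hrhs, Matrix.smul_mul, Matrix.mul_smul, smul_smul, trace_smul, smul_eq_mul, ← mul_assoc, mul_comm (2 : ℂ),
    mul_assoc, ← Complex.ofReal_mul, Complex.re_ofReal_mul]
  congr 1
  by_cases h : p + 2 * q = 0
  · rw [h, div_zero, div_zero, zero_mul]
  · field_simp

/-- **(v), SLD-free form**: for a unit `ψ`, Hermitian `A`, reals `p ≥ 0`, `q ≥ 0` with `p + 2q ≠ 0` (so that
`ρ = p|ψ⟩⟨ψ| + q𝟙 ⪰ 0`), ANY Hermitian SLD `T` of `ρ` along `A` and ANY Hermitian SLD `S₀` of `P = |ψ⟩⟨ψ|` along `A`: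
`F_Q[ρ, A] = p²/(p + 2q)·F_Q[P, A]`. [cite: Toth2012MultipartiteMetrology, §4 eq. (mixed)] [cite: TothApellaniz2014,
§4.3 (v)] -/
theorem qfi_whiteNoise_eq (hA : A.IsHermitian) (hψ : star ψ ⬝ᵥ ψ = 1) {p q : ℝ} (hp : 0 ≤ p) (hq : 0 ≤ q)
    (hpq : p + 2 * q ≠ 0) {T S₀ : Matrix n n ℂ} (hT : T.IsHermitian)
    (hTρ : T * ((p : ℂ) • vecMulVec ψ (star ψ) + (q : ℂ) • (1 : Matrix n n ℂ)) +
        ((p : ℂ) • vecMulVec ψ (star ψ) + (q : ℂ) • (1 : Matrix n n ℂ)) * T =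
      Complex.I • (((p : ℂ) • vecMulVec ψ (star ψ) + (q : ℂ) • (1 : Matrix n n ℂ)) * A -
        A * ((p : ℂ) • vecMulVec ψ (star ψ) + (q : ℂ) • (1 : Matrix n n ℂ))))
    (hS₀ : S₀.IsHermitian)
    (hS₀P : S₀ * vecMulVec ψ (star ψ) + vecMulVec ψ (star ψ) * S₀ =
      Complex.I • (vecMulVec ψ (star ψ) * A - A * vecMulVec ψ (star ψ))) :
    (2 * (T * (Complex.I • (((p : ℂ) • vecMulVec ψ (star ψ) + (q : ℂ) • (1 : Matrix n n ℂ)) * A -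
        A * ((p : ℂ) • vecMulVec ψ (star ψ) + (q : ℂ) • (1 : Matrix n n ℂ))))).trace).re =
      p ^ 2 / (p + 2 * q) *
        (2 * (S₀ * (Complex.I • (vecMulVec ψ (star ψ) * A - A * vecMulVec ψ (star ψ)))).trace).re := by
  have hP0 : (vecMulVec ψ (star ψ)).PosSemidef := posSemidef_vecMulVec_self_star ψ
  have hρ : ((p : ℂ) • vecMulVec ψ (star ψ) + (q : ℂ) • (1 : Matrix n n ℂ)).PosSemidef :=
    (hP0.smul (Complex.zero_le_real.mpr hp)).add (PosSemidef.one.smul (Complex.zero_le_real.mpr hq))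
  have hDh : (Complex.I • (vecMulVec ψ (star ψ) * A - A * vecMulVec ψ (star ψ))).IsHermitian :=
    QFIVariance.unitaryDeriv_isHermitian hP0.1 hA
  have hSh : (((p / (p + 2 * q) : ℝ) : ℂ) •
      (Complex.I • (vecMulVec ψ (star ψ) * A - A * vecMulVec ψ (star ψ)))).IsHermitian := by
    rw [Matrix.IsHermitian, conjTranspose_smul, Complex.star_def, Complex.conj_ofReal, hDh.eq]
  rw [QFIVariance.trace_sld_mul_eq_of_sld_eq hρ hT hSh hTρ (sld_whiteNoise hA hψ hpq), qfi_whiteNoise,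
    QFIVariance.trace_sld_mul_eq_of_sld_eq hP0 hDh hS₀ (sld_vecMulVec hA hψ) hS₀P]

end WhiteNoise

end Literature.InformationTheory.StateDiscrimination.QFIProperties
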